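import Summits.MatrixMultiplication.OmegaCensus.STPPHamidouneRodsethThreeNat
import Summits.MatrixMultiplication.OmegaCensus.STPPVosperSlackOneTwoRuns
import Literature.Combinatorics.Additive.IsoperimetricMethod

/-!
# ω-census (abelian STPP census): Hamidoune–Rødseth for three-element sets — two runs in value coordinates (kernel tools)

HONEST FRAMING (pub-omega census; verbatim): lottery ticket; floor = certified bounds/negative ranges.
Census STRUCTURE / KERNEL desk (seat pub-omega-stpp-2 gen 24, 2026-08-28), family (b2).  Second file of the proof of `HamidouneRodsethCard 3`
(`STPPVosperSlackOneLawCard.lean`) UNCONDITIONALLY.  Nothing here is progress on `ω`.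

## What is here (tools for `STPPHamidouneRodsethThreeTwoRuns.lean`)

`two_runs_val`: a set `T ⊆ ℤ/pℤ` with exactly two run-ends along `+1` is, after a translation by a base point `a`, the set of residues whose
value of `x − a` lies in `[0,ℓ₁) ∪ [ℓ₁+g₁, ℓ₁+g₁+ℓ₂)` (`HR3.InT`; runs `ℓ₁, ℓ₂ ≥ 1`, gaps `g₁, g₂ ≥ 1`, `ℓ₁+g₁+ℓ₂+g₂ = p`) — from the two
progressions of `two_runs_of_card_union_vadd`, their disjointness, and the run count.  `mem_U_iff`: membership in `U = T ∪ (T+1)` is `HR3.InU`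
of the value.  `val_shift`: the value of `(a+n)+v−a` is `HR3.wrap p (n + v.val)`.  Plus small value/progression bookkeeping
(`mem_apFinset_of_eq`, `triple_add_eq : {0,1,v} + T = T ∪ (1+T) ∪ (v+T)`, `card_triple`, `two_mul_inv_two`).

References: Y. O. Hamidoune, Ø. J. Rødseth, *An inverse theorem mod p*, Acta Arith. 92 (2000) 251–262 (the theorem, case `|A| = 3`);
O. Serra, G. Zémor, Integers 0 (2000) A10, Thm 3; M. B. Nathanson, GTM 165, §2.5.
-/

open Finset
open scoped Pointwise

namespace Summit.MatrixMultiplication.OmegaCensus.HR3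

open Literature.Combinatorics.Additive
open Literature.Combinatorics.Additive.Isoperimetric
open Summit.MatrixMultiplication.OmegaCensus.CubeNB (two_runs_of_card_union_vadd)

variable {p : ℕ} [hp : Fact p.Prime]

/-! ## Small tools -/

/-- Membership in a progression from an explicit index. [cite: Nathanson1996, §2.5] -/
theorem mem_apFinset_of_eq {a d x : ZMod p} {n i : ℕ} (hi : i < n) (h : a + (i : ZMod p) * d = x) :
    x ∈ apFinset a d n :=
  mem_apFinset.2 ⟨i, hi, by rw [nsmul_eq_mul]; exact h⟩

/-- `x = a + (x - a).val`. [folklore] -/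
theorem eq_add_val_sub (x a : ZMod p) : x = a + (((x - a).val : ℕ) : ZMod p) := by
  rw [ZMod.natCast_zmod_val]; ring

/-- `(a + n - a).val = n` for `n < p`. [folklore] -/
theorem val_add_natCast_sub (a : ZMod p) {n : ℕ} (hn : n < p) : (a + (n : ZMod p) - a).val = n := by
  rw [add_sub_cancel_left, ZMod.val_natCast, Nat.mod_eq_of_lt hn]

/-- The value of `y - 1 - a` from the value of `y - a`. [folklore] -/
theorem val_sub_one_sub (y a : ZMod p) :
    (y - 1 - a).val = if (y - a).val = 0 then p - 1 else (y - a).val - 1 := by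
  have hp1 : 1 < p := hp.out.one_lt
  have h1 : y - 1 - a = (y - a) - 1 := by ring
  rw [h1]
  split_ifs with h0
  · have : y - a = 0 := (ZMod.val_eq_zero _).1 h0
    rw [this, zero_sub, ZMod.val_neg_of_ne_zero, ZMod.val_one]
  · haveI : Fact (1 < p) := ⟨hp1⟩
    rw [ZMod.val_sub (by rw [ZMod.val_one]; omega), ZMod.val_one]

/-- `{0, 1, v} + T = T ∪ (1 + T) ∪ (v + T)`. [folklore] -/
theorem triple_add_eq (v : ZMod p) (T : Finset (ZMod p)) :
    ({0, 1, v} : Finset (ZMod p)) + T = (T ∪ ((1 : ZMod p) +ᵥ T)) ∪ (v +ᵥ T) := by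
  ext y
  rw [mem_union, mem_union, Finset.mem_add, mem_vadd_finset, mem_vadd_finset]
  constructor
  · rintro ⟨s, hs, t, ht, rfl⟩
    simp only [mem_insert, mem_singleton] at hs
    rcases hs with rfl | rfl | rfl
    · exact Or.inl (Or.inl (by rwa [zero_add]))
    · exact Or.inl (Or.inr ⟨t, ht, rfl⟩)
    · exact Or.inr ⟨t, ht, rfl⟩
  · rintro ((hy | ⟨t, ht, rfl⟩) | ⟨t, ht, rfl⟩)
    · exact ⟨0, by simp, y, hy, zero_add y⟩
    · exact ⟨1, by simp, t, ht, rfl⟩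
    · exact ⟨v, by simp, t, ht, rfl⟩

/-- `|{0, 1, v}| = 3` for `v ≠ 0, 1`. [folklore] -/
theorem card_triple {v : ZMod p} (hv0 : v ≠ 0) (hv1 : v ≠ 1) : #({0, 1, v} : Finset (ZMod p)) = 3 := by
  have h01 : (0 : ZMod p) ≠ 1 := by
    haveI : Fact (1 < p) := ⟨hp.out.one_lt⟩
    exact zero_ne_one
  rw [card_insert_of_notMem, card_insert_of_notMem, card_singleton]
  · simpa using hv1.symm
  · simp only [mem_insert, mem_singleton, not_or]; exact ⟨h01, hv0.symm⟩

/-! ## Two runs, in value coordinates -/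

/-- **Two runs in value coordinates.**  If `T ⊆ ℤ/pℤ` has exactly two run-ends along `+1`, then for some base point `a` and naturals
`ℓ₁, ℓ₂ ≥ 1` (run lengths), `g₁, g₂ ≥ 1` (gaps) with `ℓ₁+g₁+ℓ₂+g₂ = p`, membership in `T` is `HR3.InT ℓ₁ g₁ ℓ₂` of the value of `x − a`.
From `two_runs_of_card_union_vadd` (the two progressions), disjointness, and the run count (adjacent progressions would merge).
[cite: Nathanson1996, §2.5 Lemma 2.4 (proof idea)] -/
theorem two_runs_val {T : Finset (ZMod p)} (hT2 : #(((1 : ZMod p) +ᵥ T) \ T) = 2) (hTp : #T < p) :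
    ∃ a : ZMod p, ∃ ℓ₁ g₁ ℓ₂ g₂ : ℕ, 1 ≤ ℓ₁ ∧ 1 ≤ ℓ₂ ∧ 1 ≤ g₁ ∧ 1 ≤ g₂ ∧ ℓ₁ + g₁ + ℓ₂ + g₂ = p ∧ ℓ₁ + ℓ₂ = #T ∧
      ∀ x, x ∈ T ↔ InT ℓ₁ g₁ ℓ₂ (x - a).val := by
  classical
  have hunion : #(T ∪ ((1 : ZMod p) +ᵥ T)) = #T + 2 := by
    have := card_sdiff_add_card ((1 : ZMod p) +ᵥ T) T
    rw [union_comm] at this; omega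
  obtain ⟨c₁, c₂, ℓ₁, ℓ₂, hℓ₁, hℓ₁₂, hsum, hTeq⟩ := two_runs_of_card_union_vadd one_ne_zero hunion
  have hc1 : #(apFinset c₁ (1 : ZMod p) ℓ₁) = ℓ₁ := card_apFinset one_ne_zero (by omega)
  have hc2 : #(apFinset c₂ (1 : ZMod p) ℓ₂) = ℓ₂ := card_apFinset one_ne_zero (by omega)
  set o := (c₂ - c₁).val with ho
  have hop : o < p := ZMod.val_lt _
  have hc₂ : c₂ = c₁ + (o : ZMod p) := by rw [ho, ZMod.natCast_zmod_val]; ring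
  -- membership of the two progressions by values
  have hmem1 : ∀ x, x ∈ apFinset c₁ (1 : ZMod p) ℓ₁ ↔ (x - c₁).val < ℓ₁ := by
    intro x; rw [mem_apFinset]; constructor
    · rintro ⟨i, hi, rfl⟩
      rw [nsmul_one, val_add_natCast_sub c₁ (by omega)]; exact hi
    · intro hx
      exact ⟨(x - c₁).val, hx, by rw [nsmul_one, ZMod.natCast_zmod_val]; ring⟩
  have hmem2 : ∀ x, x ∈ apFinset c₂ (1 : ZMod p) ℓ₂ ↔ ∃ j, j < ℓ₂ ∧ (x - c₁).val = (o + j) % p := by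
    intro x; rw [mem_apFinset]; constructor
    · rintro ⟨j, hj, rfl⟩
      refine ⟨j, hj, ?_⟩
      have : c₂ + j • (1 : ZMod p) - c₁ = ((o + j : ℕ) : ZMod p) := by rw [hc₂, nsmul_one]; push_cast; ring
      rw [this, ZMod.val_natCast]
    · rintro ⟨j, hj, hx⟩
      refine ⟨j, hj, ?_⟩
      have h1 := eq_add_val_sub x c₁
      rw [hx, ZMod.natCast_mod, Nat.cast_add] at h1
      rw [h1, hc₂, nsmul_one]; ring
  -- disjointness from the cardinalities
  have hinter : apFinset c₁ (1 : ZMod p) ℓ₁ ∩ apFinset c₂ 1 ℓ₂ = ∅ := by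
    have := card_union_add_card_inter (apFinset c₁ (1 : ZMod p) ℓ₁) (apFinset c₂ 1 ℓ₂)
    rw [← hTeq, hc1, hc2, ← hsum] at this
    rw [← card_eq_zero]; omega
  have hnot : ∀ x, x ∈ apFinset c₁ (1 : ZMod p) ℓ₁ → x ∈ apFinset c₂ (1 : ZMod p) ℓ₂ → False := by
    intro x h1 h2
    have : x ∈ apFinset c₁ (1 : ZMod p) ℓ₁ ∩ apFinset c₂ 1 ℓ₂ := mem_inter.2 ⟨h1, h2⟩
    rw [hinter] at this; exact notMem_empty _ this
  -- `c₂` is not in the first run: `o ≥ ℓ₁`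
  have ho1 : ℓ₁ ≤ o := by
    by_contra h
    have h' : o < ℓ₁ := by omega
    refine hnot c₂ ((hmem1 c₂).2 h') ((hmem2 c₂).2 ⟨0, by omega, ?_⟩)
    rw [add_zero, Nat.mod_eq_of_lt hop]
  -- `c₁` is not in the second run: `o + ℓ₂ ≤ p`
  have ho2 : o + ℓ₂ ≤ p := by
    by_contra h
    have h' : p - o < ℓ₂ := by omega
    refine hnot c₁ ((hmem1 c₁).2 (by rw [sub_self, ZMod.val_zero]; exact hℓ₁)) ((hmem2 c₁).2 ⟨p - o, h', ?_⟩)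
    rw [sub_self, ZMod.val_zero, show o + (p - o) = p by omega, Nat.mod_self]
  -- membership in `T` by values
  have hmemT : ∀ x, x ∈ T ↔ InT ℓ₁ (o - ℓ₁) ℓ₂ (x - c₁).val := by
    intro x
    rw [hTeq, mem_union, hmem1, hmem2]
    unfold InT
    constructor
    · rintro (h | ⟨j, hj, hx⟩)
      · exact Or.inl h
      · right; rw [Nat.mod_eq_of_lt (by omega)] at hx; omega
    · rintro (h | ⟨h1, h2⟩)
      · exact Or.inl h
      · right; exact ⟨(x - c₁).val - o, by omega, by rw [Nat.mod_eq_of_lt (by omega)]; omega⟩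
  -- the gaps are nonempty: otherwise `T` is a single progression and has one run-end
  have hrun : ∀ c : ZMod p, T = apFinset c 1 (ℓ₁ + ℓ₂) → False := by
    intro c hc
    have := card_vadd_sdiff_apFinset_le_one c (1 : ZMod p) (ℓ₁ + ℓ₂)
    rw [← hc] at this; omega
  have hg1 : ℓ₁ + 1 ≤ o := by
    by_contra h
    have hoeq : o = ℓ₁ := by omega
    refine hrun c₁ ?_
    rw [apFinset_add_eq_union, hTeq, nsmul_one, hc₂, hoeq]
  have hg2 : o + ℓ₂ + 1 ≤ p := by
    by_contra h
    have hoeq : o + ℓ₂ = p := by omega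
    refine hrun c₂ ?_
    rw [add_comm ℓ₁ ℓ₂, apFinset_add_eq_union, hTeq, union_comm, nsmul_one, hc₂]
    have : c₁ + (o : ZMod p) + (ℓ₂ : ZMod p) = c₁ := by
      have h0 : ((o + ℓ₂ : ℕ) : ZMod p) = 0 := by rw [hoeq, ZMod.natCast_self]
      push_cast at h0; linear_combination h0
    rw [this]
  exact ⟨c₁, ℓ₁, o - ℓ₁, ℓ₂, p - o - ℓ₂, hℓ₁, by omega, by omega, by omega, by omega, hsum, hmemT⟩

/-- Membership in `U = T ∪ (1 + T)` by values. [folklore] -/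
theorem mem_U_iff {T : Finset (ZMod p)} {a : ZMod p} {ℓ₁ g₁ ℓ₂ g₂ : ℕ} (hℓ₁ : 1 ≤ ℓ₁) (hℓ₂ : 1 ≤ ℓ₂)
    (hp' : ℓ₁ + g₁ + ℓ₂ + g₂ = p)
    (hmem : ∀ x, x ∈ T ↔ InT ℓ₁ g₁ ℓ₂ (x - a).val) (y : ZMod p) :
    y ∈ T ∪ ((1 : ZMod p) +ᵥ T) ↔ InU ℓ₁ g₁ ℓ₂ (y - a).val := by
  have hy1 : y ∈ (1 : ZMod p) +ᵥ T ↔ y - 1 ∈ T := by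
    rw [mem_vadd_finset]; constructor
    · rintro ⟨t, ht, rfl⟩; rw [vadd_eq_add, add_sub_cancel_left]; exact ht
    · intro h; exact ⟨y - 1, h, by rw [vadd_eq_add]; ring⟩
  rw [mem_union, hy1, hmem, hmem, val_sub_one_sub]
  have hlt : (y - a).val < p := ZMod.val_lt _
  unfold InT InU
  split_ifs with h0 <;> omega

/-- The value of `(a + n) + v − a` is `wrap p (n + v.val)`. [folklore] -/
theorem val_shift (a v : ZMod p) {n : ℕ} (hn : n < p) : (a + (n : ZMod p) + v - a).val = wrap p (n + v.val) := by
  have : a + (n : ZMod p) + v - a = ((n + v.val : ℕ) : ZMod p) := by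
    push_cast; rw [ZMod.natCast_zmod_val]; ring
  rw [this, ZMod.val_natCast]
  unfold wrap
  have hv := ZMod.val_lt v
  split_ifs with h
  · exact Nat.mod_eq_of_lt h
  · rw [Nat.mod_eq_sub_mod (by omega), Nat.mod_eq_of_lt (by omega)]

/-- `2 · 2⁻¹ = 1` in `ℤ/pℤ` for an odd prime `p`. [folklore] -/
theorem two_mul_inv_two (hodd : p % 2 = 1) : (2 : ZMod p) * (2 : ZMod p)⁻¹ = 1 := by
  have h2 : (2 : ZMod p) ≠ 0 := by
    intro h
    have : ((2 : ℕ) : ZMod p) = 0 := by exact_mod_cast h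
    rw [ZMod.natCast_eq_zero_iff] at this
    have := Nat.le_of_dvd (by norm_num) this
    have := hp.out.two_le
    omega
  exact mul_inv_cancel₀ h2

end Summit.MatrixMultiplication.OmegaCensus.HR3
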